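import Mathlib
import Summits.ValiantsHypothesis.ValiantsHypothesis.Theorems.NewtonTauWeak.Negative.Zonogon
import Summits.ValiantsHypothesis.ValiantsHypothesis.Theorems.NewtonUnitEquationsNewtonTauWeakSeparatedRank
import Summits.ValiantsHypothesis.ValiantsHypothesis.Theorems.NewtonUnitEquationsNewtonTauWeakVdpDefs
import Summits.ValiantsHypothesis.ValiantsHypothesis.Theorems.NewtonUnitEquationsNewtonTauWeakStubVertexCharts
import Summits.ValiantsHypothesis.ValiantsHypothesis.Theorems.NewtonUnitEquationsNewtonTauWeakStubChartPairCount
import Summits.ValiantsHypothesis.ValiantsHypothesis.Theorems.NewtonUnitEquationsNewtonTauWeakStubProductVertices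

/-!
# `NewtonUnitEquationsNewtonTauWeakHexagonTrichotomy` — Δ-Wronskian rung: the initial-term trichotomy

Rung toward `stub_binomialNewtonTauCommon` (crux `NewtonTauWeak`, stmt-ValiantsHypothesis-5904), line
`binomial-normal-form`, lead c3: the GLOBAL Δ-WRONSKIAN argument for sums of three hexagon products
`A(x)·B(y)·C(xy)` (exponent lists on the three lines through `(1,0)`, `(0,1)`, `(1,1)`; any degrees).

This file (lead): the heart of the argument.  Let `Δ` be any self-map of `ℂ[X,Y]` with
`coeff e (Δ p) = (e₀ - e₁)·coeff e p` (the Euler derivation `X∂_X - Y∂_Y`), and suppose polynomials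
satisfy a linear `Δ`-identity `N₀·F - N₁·ΔF + N₂·Δ²F = W` (in the application: Cramer's rule for the
Wronskian matrix of three summands of `F`).  Fix a GENERIC weight `w` (injective weighted degree), let
`v` be the strict `w`-top of `F` off the diagonal (`v₀ ≠ v₁`, so `v` is also the top of `ΔF`, `Δ²F` with
coefficients scaled by `σ = v₀ - v₁`), and let `z` be the strict `w`-top of a polynomial `U` whose support
is `supp N₀ ∪ supp N₁ ∪ supp N₂`.  Then the coefficient of `X^{z+v}` on the left is
`coeff v F · P_z(σ)` with `P_z(t) = coeff z N₀ - coeff z N₁·t + coeff z N₂·t²`, and every other monomial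
on the left is `w`-lighter; hence the **trichotomy** (`hex_key_trichotomy`): `P_z(σ) = 0`, or `W ≠ 0`
and `z + v` is the strict top of `W` — the vertex `v` is then DETERMINED by the pair of simultaneous tops
`(top W, top U)`, which the chart-pair count of the vdp line bounds.  The fully degenerate companion
(`hex_degenerate_line`): if all pairwise `2 × 2` Wronskians `g_a Δg_b - g_b Δg_a` of the summands vanish,
then `g_a·ΔF = Δg_a·F`, and comparing tops puts `v` on the anti-diagonal `e₀ - e₁ = z₀ - z₁` of the
simultaneous top `z` of `g_a`. [folklore: Voorhoeve–van der Poorten / Koiran–Portier–Tavenas Wronskian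
method, here with the direction-killing derivation]
-/

set_option linter.dupNamespace false

noncomputable section

namespace Summit.ValiantsHypothesis.ValiantsHypothesis.Theorems.NewtonUnitEquationsNewtonTauWeak

open scoped BigOperators
open MvPolynomial
open Literature.Computability.AlgebraicComplexity (newtonVertexCount)
open Summit.ValiantsHypothesis.ValiantsHypothesis.Theorems.NewtonTauWeakVdp
open Summit.ValiantsHypothesis.ValiantsHypothesis.Theorems.NewtonTauWeak.Negative (vert)

/-! ## Dominant exponents: the coefficient at the sum of two tops -/

/-- **Coefficient at the sum of dominating exponents.** If every support exponent of `N` weighs at most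
`z` and every support exponent of `F` at most `v` (generic weight), then the coefficient of `X^{z+v}` in
`N·F` is the single product `coeff z N · coeff v F`: any other splitting `z + v = a + b` with `a ∈ supp N`,
`b ∈ supp F` would force `wdeg a = wdeg z`, `wdeg b = wdeg v`, i.e. `(a, b) = (z, v)`. [folklore] -/
theorem hex_coeff_mul_add_of_dominant {w : Fin 2 → ℝ} (hw : IsGeneric w) (N F : MvPolynomial (Fin 2) ℂ)
    (z v : Fin 2 →₀ ℕ) (hN : ∀ a ∈ N.support, wdeg w a ≤ wdeg w z) (hF : ∀ b ∈ F.support, wdeg w b ≤ wdeg w v) :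
    coeff (z + v) (N * F) = coeff z N * coeff v F := by
  classical
  rw [coeff_mul]
  have hmem : (z, v) ∈ Finset.HasAntidiagonal.antidiagonal (z + v) :=
    Finset.HasAntidiagonal.mem_antidiagonal.mpr rfl
  rw [Finset.sum_eq_single_of_mem (z, v) hmem]
  rintro ⟨a, b⟩ hab hne
  rw [Finset.HasAntidiagonal.mem_antidiagonal] at hab
  by_contra h
  obtain ⟨ha, hb⟩ := mul_ne_zero_iff.mp h
  have ha' : a ∈ N.support := mem_support_iff.mpr ha
  have hb' : b ∈ F.support := mem_support_iff.mpr hb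
  have h1 := hN a ha'
  have h2 := hF b hb'
  have hsum : wdeg w a + wdeg w b = wdeg w z + wdeg w v := by
    rw [← wdeg_add, ← wdeg_add, hab]
  have hza : wdeg w a = wdeg w z := by linarith
  have hvb : wdeg w b = wdeg w v := by linarith
  exact hne (Prod.ext (hw hza) (hw hvb))

/-- Every OTHER support exponent of `N·F` is strictly lighter than `z + v` (same hypotheses). [folklore] -/
theorem hex_wdeg_lt_of_mem_support_mul {w : Fin 2 → ℝ} (hw : IsGeneric w) (N F : MvPolynomial (Fin 2) ℂ)
    (z v : Fin 2 →₀ ℕ) (hN : ∀ a ∈ N.support, wdeg w a ≤ wdeg w z) (hF : ∀ b ∈ F.support, wdeg w b ≤ wdeg w v)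
    {e : Fin 2 →₀ ℕ} (he : e ∈ (N * F).support) (hne : e ≠ z + v) : wdeg w e < wdeg w (z + v) := by
  classical
  obtain ⟨a, ha, b, hb, rfl⟩ := Finset.mem_add.mp (support_mul N F he)
  have h1 := hN a ha
  have h2 := hF b hb
  rw [wdeg_add, wdeg_add]
  rcases h1.lt_or_eq with hlt | heq
  · linarith
  · rcases h2.lt_or_eq with hlt' | heq'
    · linarith
    · exact absurd (by rw [hw heq, hw heq']) hne

/-! ## Tops of `Δ F` -/

/-- At an off-diagonal strict top `v` of `F` (`v₀ ≠ v₁`), `v` is also the strict top of `Δ F`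
(`coeff v (ΔF) = (v₀ - v₁)·coeff v F ≠ 0` and `supp ΔF ⊆ supp F`). [folklore] -/
theorem hex_isTop_delta (Δ : MvPolynomial (Fin 2) ℂ → MvPolynomial (Fin 2) ℂ)
    (hΔ : ∀ p e, coeff e (Δ p) = (((e 0 : ℕ) : ℂ) - ((e 1 : ℕ) : ℂ)) * coeff e p)
    {w : Fin 2 → ℝ} {F : MvPolynomial (Fin 2) ℂ} {v : Fin 2 →₀ ℕ} (hv : IsTop w F v) (hσ : v 0 ≠ v 1) :
    IsTop w (Δ F) v := by
  refine ⟨?_, fun e' he' hne => ?_⟩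
  · rw [mem_support_iff, hΔ]
    refine mul_ne_zero ?_ (mem_support_iff.mp hv.mem)
    rw [sub_ne_zero]
    exact_mod_cast hσ
  · have he'F : e' ∈ F.support := by
      rw [mem_support_iff] at he' ⊢
      rw [hΔ] at he'
      exact right_ne_zero_of_mul he'
    exact hv.lt he'F hne

namespace HexagonTrichotomy

/-- The coefficient of `Δ F` at an exponent. [folklore] -/
theorem coeff_delta_top (Δ : MvPolynomial (Fin 2) ℂ → MvPolynomial (Fin 2) ℂ)
    (hΔ : ∀ p e, coeff e (Δ p) = (((e 0 : ℕ) : ℂ) - ((e 1 : ℕ) : ℂ)) * coeff e p)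
    (F : MvPolynomial (Fin 2) ℂ) (v : Fin 2 →₀ ℕ) :
    coeff v (Δ (Δ F)) = (((v 0 : ℕ) : ℂ) - ((v 1 : ℕ) : ℂ)) ^ 2 * coeff v F := by
  rw [hΔ, hΔ]; ring

/-- `Δ` of a finite sum (from the coefficient law). [folklore] -/
theorem delta_sum' (Δ : MvPolynomial (Fin 2) ℂ → MvPolynomial (Fin 2) ℂ)
    (hΔ : ∀ p e, coeff e (Δ p) = (((e 0 : ℕ) : ℂ) - ((e 1 : ℕ) : ℂ)) * coeff e p)
    {ι : Type*} (s : Finset ι) (f : ι → MvPolynomial (Fin 2) ℂ) :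
    Δ (∑ i ∈ s, f i) = ∑ i ∈ s, Δ (f i) := by
  ext e
  rw [hΔ, coeff_sum, coeff_sum, Finset.mul_sum]
  exact Finset.sum_congr rfl fun i _ => (hΔ (f i) e).symm

/-- A strict top dominates the support weights. [folklore] -/
theorem le_of_isTop {w : Fin 2 → ℝ} {p : MvPolynomial (Fin 2) ℂ} {e : Fin 2 →₀ ℕ} (h : IsTop w p e) :
    ∀ a ∈ p.support, wdeg w a ≤ wdeg w e := fun _ ha => h.le ha

end HexagonTrichotomy

open HexagonTrichotomy

/-! ## The trichotomy -/

/-- **Key trichotomy.** Let `N₀·F - N₁·ΔF + N₂·Δ²F = W`, `w` generic, `v` the strict top of `F` with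
`v₀ ≠ v₁`, and `z` the strict top of `U` where `supp U = supp N₀ ∪ supp N₁ ∪ supp N₂`.  With
`σ = v₀ - v₁`: either `coeff z N₀ - coeff z N₁·σ + coeff z N₂·σ² = 0`, or `W ≠ 0` and `z + v` is the
strict top of `W`.  Proof: the coefficient of `X^{z+v}` in the left-hand side is `coeff v F · P_z(σ)`
(`hex_coeff_mul_add_of_dominant`, the tops of `ΔF`, `Δ²F` being `v` with coefficients `σ·F_v`,
`σ²·F_v`), and every other monomial of the left-hand side is strictly lighter
(`hex_wdeg_lt_of_mem_support_mul`). [folklore] -/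
theorem hex_key_trichotomy (Δ : MvPolynomial (Fin 2) ℂ → MvPolynomial (Fin 2) ℂ)
    (hΔ : ∀ p e, coeff e (Δ p) = (((e 0 : ℕ) : ℂ) - ((e 1 : ℕ) : ℂ)) * coeff e p)
    (N₀ N₁ N₂ F W U : MvPolynomial (Fin 2) ℂ) (hid : N₀ * F - N₁ * Δ F + N₂ * Δ (Δ F) = W)
    (hU : U.support = N₀.support ∪ N₁.support ∪ N₂.support)
    {w : Fin 2 → ℝ} (hw : IsGeneric w) {v z : Fin 2 →₀ ℕ} (hv : IsTop w F v) (hσ : v 0 ≠ v 1)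
    (hz : IsTop w U z) :
    coeff z N₀ - coeff z N₁ * ((((v 0 : ℕ) : ℂ)) - ((v 1 : ℕ) : ℂ)) +
        coeff z N₂ * ((((v 0 : ℕ) : ℂ)) - ((v 1 : ℕ) : ℂ)) ^ 2 = 0 ∨
      (W ≠ 0 ∧ IsTop w W (z + v)) := by
  classical
  set σv : ℂ := (((v 0 : ℕ) : ℂ)) - ((v 1 : ℕ) : ℂ) with hσv
  -- dominance data
  have hv1 : IsTop w (Δ F) v := hex_isTop_delta Δ hΔ hv hσ
  have hv2 : IsTop w (Δ (Δ F)) v := hex_isTop_delta Δ hΔ hv1 hσ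
  have hN : ∀ i : Fin 3, ∀ a ∈ (![N₀, N₁, N₂] i).support, wdeg w a ≤ wdeg w z := by
    intro i a ha
    apply hz.le
    rw [hU]
    fin_cases i
    · exact Finset.mem_union_left _ (Finset.mem_union_left _ ha)
    · exact Finset.mem_union_left _ (Finset.mem_union_right _ ha)
    · exact Finset.mem_union_right _ ha
  have hN0 := hN 0
  have hN1 := hN 1
  have hN2 := hN 2
  simp only [Matrix.cons_val_zero, Matrix.cons_val_one, Matrix.cons_val] at hN0 hN1 hN2
  -- the coefficient of `X^{z+v}` on the left
  have c0 : coeff (z + v) (N₀ * F) = coeff z N₀ * coeff v F :=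
    hex_coeff_mul_add_of_dominant hw N₀ F z v hN0 (le_of_isTop hv)
  have c1 : coeff (z + v) (N₁ * Δ F) = coeff z N₁ * (σv * coeff v F) := by
    rw [hex_coeff_mul_add_of_dominant hw N₁ (Δ F) z v hN1 (le_of_isTop hv1), hΔ]
  have c2 : coeff (z + v) (N₂ * Δ (Δ F)) = coeff z N₂ * (σv ^ 2 * coeff v F) := by
    rw [hex_coeff_mul_add_of_dominant hw N₂ (Δ (Δ F)) z v hN2 (le_of_isTop hv2),
      coeff_delta_top Δ hΔ]
  have cW : coeff (z + v) W =
      coeff v F * (coeff z N₀ - coeff z N₁ * σv + coeff z N₂ * σv ^ 2) := by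
    rw [← hid, coeff_add, coeff_sub, c0, c1, c2]; ring
  by_cases hP : coeff z N₀ - coeff z N₁ * σv + coeff z N₂ * σv ^ 2 = 0
  · exact Or.inl hP
  · right
    have hFv : coeff v F ≠ 0 := mem_support_iff.mp hv.mem
    have hWc : coeff (z + v) W ≠ 0 := by rw [cW]; exact mul_ne_zero hFv hP
    refine ⟨fun h => hWc (by rw [h, coeff_zero]), mem_support_iff.mpr hWc, fun e' he' hne => ?_⟩
    -- every other monomial of the left-hand side is lighter
    rw [← hid] at he'
    have hcases : e' ∈ (N₀ * F).support ∨ e' ∈ (N₁ * Δ F).support ∨ e' ∈ (N₂ * Δ (Δ F)).support := by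
      have h1 := support_add he'
      rcases Finset.mem_union.mp h1 with h | h
      · have hsub : (N₀ * F - N₁ * Δ F).support ⊆ (N₀ * F).support ∪ (N₁ * Δ F).support :=
          support_sub ..
        rcases Finset.mem_union.mp (hsub h) with h' | h'
        · exact Or.inl h'
        · exact Or.inr (Or.inl h')
      · exact Or.inr (Or.inr h)
    rcases hcases with h | h | h
    · exact hex_wdeg_lt_of_mem_support_mul hw N₀ F z v hN0 (le_of_isTop hv) h hne
    · exact hex_wdeg_lt_of_mem_support_mul hw N₁ (Δ F) z v hN1 (le_of_isTop hv1) h hne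
    · exact hex_wdeg_lt_of_mem_support_mul hw N₂ (Δ (Δ F)) z v hN2 (le_of_isTop hv2) h hne

/-! ## The fully degenerate case -/

/-- **Degenerate case.** If all pairwise `2 × 2` Wronskians of the summands vanish
(`g_a·Δg_b = g_b·Δg_a`), then `g_a·ΔF = F·Δg_a` for `F = Σ g_b`; if `Δg_a ≠ 0` and `v` is an off-diagonal
strict top of `F` for a generic weight, comparing the tops `top g_a + v` and `v + top Δg_a` of the two
sides and then their coefficients `g_z·σ_v·F_v = F_v·σ_z·g_z` shows that the simultaneous strict top `z`
of `g_a` has the same anti-diagonal `z₀ - z₁ = v₀ - v₁`. [folklore] -/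
theorem hex_degenerate_line (Δ : MvPolynomial (Fin 2) ℂ → MvPolynomial (Fin 2) ℂ)
    (hΔ : ∀ p e, coeff e (Δ p) = (((e 0 : ℕ) : ℂ) - ((e 1 : ℕ) : ℂ)) * coeff e p)
    {k : ℕ} (g : Fin k → MvPolynomial (Fin 2) ℂ) (hW : ∀ a b, g a * Δ (g b) = g b * Δ (g a))
    (a : Fin k) (ha : Δ (g a) ≠ 0)
    {w : Fin 2 → ℝ} (hw : IsGeneric w) {v : Fin 2 →₀ ℕ} (hv : IsTop w (∑ b, g b) v) (hσ : v 0 ≠ v 1) :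
    ∃ z, IsTop w (g a) z ∧ ((z 0 : ℕ) : ℤ) - ((z 1 : ℕ) : ℤ) = ((v 0 : ℕ) : ℤ) - ((v 1 : ℕ) : ℤ) := by
  classical
  set F := ∑ b, g b with hF
  -- the relation `g_a ΔF = F Δg_a`
  have hrel : g a * Δ F = F * Δ (g a) := by
    rw [hF, delta_sum' Δ hΔ, Finset.mul_sum, Finset.sum_mul]
    exact Finset.sum_congr rfl fun b _ => hW a b
  -- `g_a ≠ 0`
  have hga : g a ≠ 0 := by
    intro h
    apply ha
    ext e
    rw [hΔ, h, coeff_zero, mul_zero]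
  obtain ⟨z, hz⟩ := exists_isTop hw hga
  obtain ⟨z', hz'⟩ := exists_isTop hw ha
  have hv1 : IsTop w (Δ F) v := hex_isTop_delta Δ hΔ hv hσ
  -- tops of the two sides
  have t1 : IsTop w (g a * Δ F) (z + v) := ProductVertices.isTop_mul hz hv1
  have t2 : IsTop w (F * Δ (g a)) (v + z') := ProductVertices.isTop_mul hv hz'
  rw [hrel] at t1
  have hzz : z = z' := by
    have h := t1.unique t2
    rw [add_comm v z'] at h
    exact add_right_cancel h
  -- coefficients of the two sides at `z + v`
  have e1 : coeff (z + v) (g a * Δ F) = coeff z (g a) * ((((v 0 : ℕ) : ℂ) - ((v 1 : ℕ) : ℂ)) * coeff v F) := by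
    rw [hex_coeff_mul_add_of_dominant hw (g a) (Δ F) z v (le_of_isTop hz) (le_of_isTop hv1), hΔ]
  have e2 : coeff (z + v) (F * Δ (g a)) = coeff v F * ((((z 0 : ℕ) : ℂ) - ((z 1 : ℕ) : ℂ)) * coeff z (g a)) := by
    rw [add_comm z v, hex_coeff_mul_add_of_dominant hw F (Δ (g a)) v z (le_of_isTop hv) ?_, hΔ]
    rw [hzz]; exact le_of_isTop hz'
  rw [hrel] at e1
  rw [e1] at e2
  have hgz : coeff z (g a) ≠ 0 := mem_support_iff.mp hz.mem
  have hFv : coeff v F ≠ 0 := mem_support_iff.mp hv.mem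
  have key : (((v 0 : ℕ) : ℂ) - ((v 1 : ℕ) : ℂ)) = (((z 0 : ℕ) : ℂ) - ((z 1 : ℕ) : ℂ)) := by
    have h2 : coeff z (g a) * coeff v F ≠ 0 := mul_ne_zero hgz hFv
    apply mul_left_cancel₀ h2
    linear_combination e2
  refine ⟨z, hz, ?_⟩
  have key' : (((((z 0 : ℕ) : ℤ) - ((z 1 : ℕ) : ℤ) : ℤ)) : ℂ) = (((((v 0 : ℕ) : ℤ) - ((v 1 : ℕ) : ℤ) : ℤ)) : ℂ) := by
    push_cast; exact key.symm
  exact_mod_cast key'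

end Summit.ValiantsHypothesis.ValiantsHypothesis.Theorems.NewtonUnitEquationsNewtonTauWeak

end
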